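import Summits.BirchSwinnertonDyer.Rank1Residual.X12.CMGoodOddPrime
import Literature.NumberTheory.EllipticCurves.NonvanishingTwistsPrescribedSplitting
import HarnessLib

/-!
# CM, analytic rank one, ANY odd prime `p` unramified in the CM field, ANY conductor: the upper
# half of `BSD(E,p)` from PUBLISHED facts; at a GOOD such `p` (Kobayashi's corner, `p = 3`
# included) for EVERY curve with no Manin datum — the odd-conductor complement of
# `CMGoodOddPrime.lean`

HONEST FRAMING (cell `b2b-bsdres`, run/shared/lean/b2b/bsd-rank1-residual/, verbatim in every
file): the goal of the cell is to DELETE the COMBINATION-SHAPED residual classes of the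
Birch–Swinnerton-Dyer formula for ALL analytic-rank `≤ 1` elliptic curves over `ℚ` — "full BSD
formula for every rank `≤ 1` curve in class `C`" assembled STRICTLY from published theorems — so
that the rank-`≤ 1` remainder becomes exactly the CONSTRUCTION-SHAPED classes, which are TYPED
(missing-input `Prop`s), NOT attempted. This is not "finishing BSD". Unit `b2b-bsdres-x1b` (X12
prover owner), generation 21; research route, no claim beyond the stated class; X12 REMAINS
CONSTRUCTION-SHAPED; nothing is booked here — booking is the lane's and the referee's.

Theorems only; no definition, no new named fact in this file (its one new published input, the
finite-set form of Friedberg–Hoffstein's non-vanishing theorem, is the Literature fact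
`friedbergHoffstein_exists_heegnerField_splitDivisors_twist_ne_zero`,
`NonvanishingTwistsPrescribedSplitting.lean`).

`CMGoodOddPrime.lean` (same gen) needed `2 ∣ N` only to make the Heegner field's discriminant
odd, the ONE auxiliary prime of the tree's older Friedberg–Hoffstein fact being spent on `p`. With
the finite-set form (binder `hFH2`; auxiliary integer `M = 2p`: both `2` and `p` split in the
Heegner field `K'`, so `d_{K'}` is odd and prime to `p`) the hypothesis `2 ∣ N` disappears:

* §1 `padicValNat_shaOrder_le_of_hasCM_rankOne_of_odd` — for `W/ℚ` globally minimal, CM,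
  `ord_{s=1} L(E,s) = 1`, `p ≠ 2` UNRAMIFIED in the CM field (no hypothesis on the reduction at
  `p`, none on the conductor), and a parametrisation datum `D` at level `N` with `p ∤ c(D)`:
  `#Ш(E)_an = q ∈ ℚ` with `ord_p #Ш(E) ≤ ord_p q + 2·ord_p ∏_ℓ c_ℓ(E)`;
  `missingUpperBoundAt_of_hasCM_rankOne_of_odd` (+ `p ∤ ∏ c_ℓ`);
  `bsdp_of_hasCM_rankOne_of_odd_of_shaAn_unit` (route T-KR with the curve's own Manin datum).
* §2 at a GOOD such `p`, EVERY curve, NO Manin datum (Mazur 1978 Cor. 4.1 on the modularity-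
  supplied lattice-optimal member + Cassels, as in `CMGoodOddPrime.lean` §2):
  `missingUpperBoundAt_of_hasCM_rankOne_of_good_odd`, `bsdp_iff_missingLowerBoundAt_…`, and
  **route T-KR3G for ANY conductor**: `bsdp_of_hasCM_rankOne_of_good_odd_of_shaAn_unit` —
  `BSD(E,p)` at a good odd `p ∤ d_K` of a CM curve of analytic rank one from `r_an = 1`, a
  certified `p`-adic unit `#Ш(E)_an` and the class Tamagawa datum ALONE (the 25 odd-conductor
  classes among the 225 `T-KOB13@3`-held ones included); §3: at `p ≥ 5` no datum at all.

So the partition's "odd GOOD `p`, CM, `r_an = 1`" corner — routed to Kobayashi 2013 Cor. 1.4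
(`Kobayashi2013.cor14_bsdp_of_cm_rank_one`, primary unread) — has, at every `p ∤ d_K`, an
INDEPENDENT basis for EVERY curve from read primaries modulo the curve's own LOWER half, which is
trivial per pair when `ord_p #Ш(E)_an = 0`. Not claimed: `p = 2`; `p` ramified in the CM field
(`K = ℚ(√−p)`: `E[p]` reducible); the lower half itself.

References: [FriedbergHoffstein1995] Thm. B; [JetchevSkinnerWan2017] §7.4.1–7.4.2;
[MatarNekovar2019] Thm. 0.3, §0.11; [BurungaleFlach2024] Thm. 1.1 / Cor. 2; [Mazur1978] Cor. 4.1;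
[MilneADT2006] I.7.3; [Miller2011LMS] Def. 1.1; HOME `b2b-bsdres-x1b/X12-ROUTE.md` §25.
-/

noncomputable section

open scoped Classical NumberField

open WeierstrassCurve NumberField Literature.NumberTheory.EllipticCurves
  Literature.NumberTheory.EllipticCurves.ModularForms
  Literature.NumberTheory.EllipticCurves.Rank1Residual
  Literature.NumberTheory.EllipticCurves.Rank1Residual.Typed
  Literature.NumberTheory.Automorphic
  IsDedekindDomain

namespace Summit.BirchSwinnertonDyer.Rank1Residual.X12

variable
  (hGZ : ∀ (N : ℕ) [NeZero N] (W : WeierstrassCurve ℚ) (K : Type) [Field K] [NumberField K],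
    gross_zagier N W K)
  (hKo : ∀ (N : ℕ) [NeZero N] (W : WeierstrassCurve ℚ) (K : Type) [Field K] [NumberField K],
    kolyvagin N W K)
  (hMN : ∀ (N : ℕ) [NeZero N] (W : WeierstrassCurve ℚ) (K : Type) [Field K] [NumberField K],
    MatarNekovar2019.thm03_padicValNat_card_sha_le_of_irreducible N W K)
  (hGZK : rank_eq_analyticRank_of_analyticRank_le_one) (hmod : hasEntireLFunction_rat)
  (hnf : exists_isNewformOf)
  (hFH2 : friedbergHoffstein_exists_heegnerField_splitDivisors_twist_ne_zero)
  (hCM8 : bsdTriple_of_hasCM_of_L_one_ne_zero)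

include hGZ hKo hMN hGZK hmod hnf hFH2 hCM8

/-! ### §1 Data → class: ANY odd prime unramified in the CM field, ANY conductor -/

/-- **Kolyvagin's Tamagawa defect for a CM curve of analytic rank one at ANY odd prime unramified
in the CM field, ANY conductor — from PUBLISHED facts only.** Let `W/ℚ` be a globally minimal CM
curve (`hCM`) with `ord_{s=1} L(E,s) = 1`, `p ≠ 2` UNRAMIFIED in the CM field (`¬ CMRamified W p`;
good or bad at `p`), and `D` a modular parametrisation datum of level `N_E` with `p ∤ c(D)`. Then
`#Ш(E)_an = q ∈ ℚ` with `ord_p #Ш(E) ≤ ord_p q + 2·ord_p ∏_ℓ c_ℓ(E)`. Proof = that of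
`padicValNat_shaOrder_le_of_hasCM_rankOne_of_odd_of_two_dvd` with the Friedberg–Hoffstein field
taken split at `2` AND at `p` (`hFH2`, `M = 2p`): `d_{K'}` odd and prime to `p` with no hypothesis on
`N`. [cite: FriedbergHoffstein1995, Thm. B] [cite: MatarNekovar2019, Thm. 0.3, §0.4, §0.11]
[cite: JetchevSkinnerWan2017, §7.4.1–7.4.2 (pp. 30–31)] [cite: BurungaleFlach2024, Thm. 1.1 and Cor. 2]
[cite: SilvermanATAEC1994, IV.9.4 Step 6 and Table 4.1] [cite: Darmon2004, Thm. 3.6 and §3.7]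
[cite: Miller2011LMS, Def. 1.1] -/
theorem padicValNat_shaOrder_le_of_hasCM_rankOne_of_odd
    (W : WeierstrassCurve ℚ) [W.IsElliptic] [W.IsGloballyMinimal] (p : ℕ) [Fact p.Prime]
    [NeZero (W.conductorNorm ℤ)]
    (hCM : W.HasCM) (hr : W.analyticRank = 1) (hp2 : p ≠ 2) (hnr : ¬ CMRamified W p)
    (D : ModularParametrizationData W (W.conductorNorm ℤ)) (hc : ¬ (p : ℤ) ∣ D.c) :
    ∃ q : ℚ, shaAn W = (q : ℂ) ∧
      (padicValNat p W.shaOrder : ℤ) ≤ padicValRat p q + 2 * padicValNat p W.tamagawaProduct := by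
  have hp : p.Prime := Fact.out
  have hirr : Irr W p := irr_of_not_cmRamified W p hp2 hnr
  have hw : W.rootNumber = -1 := by
    rw [WeierstrassCurve.rootNumber_eq_neg_one_pow_analyticRank_of_exists_isNewformOf hnf W, hr]
    norm_num
  -- the auxiliary field: every `ℓ ∣ N` split, `2` split, `p` split, `|d_K'| > 4`, `L(E^{d_K'},1) ≠ 0`
  obtain ⟨K, _, _, hK, hdisc, hHN, hH2, hHp, hLt⟩ :=
    exists_heegnerField_split_two_primes_twist_ne_zero hFH2 W hw Nat.prime_two hp 4
  have hodd : Odd (NumberField.discr K) := by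
    have h2 : ¬ (2 : ℤ) ∣ NumberField.discr K := by
      simpa using Literature.SatisfiesHeegnerHypothesis.not_dvd_discr hK.1 hH2 Nat.prime_two
        (dvd_refl 2)
    exact Int.not_even_iff_odd.mp fun he ↦ h2 (even_iff_two_dvd.mp he)
  have hpd : ¬ (p : ℤ) ∣ NumberField.discr K :=
    Literature.SatisfiesHeegnerHypothesis.not_dvd_discr hK.1 hHp hp (dvd_refl p)
  have hneg : NumberField.discr K < 0 := by
    haveI : IsTotallyComplex K := hK.2
    exact discr_neg_of_finrank_eq_two K hK.1
  have h4 : NumberField.discr K < -4 := by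
    have habs : ((NumberField.discr K).natAbs : ℤ) = -NumberField.discr K :=
      Int.ofNat_natAbs_of_nonpos hneg.le
    have : (4 : ℤ) < ((NumberField.discr K).natAbs : ℤ) := by exact_mod_cast hdisc
    omega
  have hμ : ¬ p ∣ Units.torsionOrder K := by
    rw [Literature.NumberTheory.DiophantineGeometry.torsionOrder_eq_two_of_discr_lt hK.1 h4]
    intro h2
    have := Nat.le_of_dvd two_pos h2
    interval_cases p <;> simp_all
  have hD3 : NumberField.discr K ≠ -3 := by omega
  have hD4 : NumberField.discr K ≠ -4 := by omega
  obtain ⟨β, hβ⟩ := exists_dvd_sq_sub_discr_holds (W.conductorNorm ℤ) K hK hHN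
  obtain ⟨H, -⟩ := nonempty_heegnerDatum_holds (W.conductorNorm ℤ) K hK hβ
  obtain ⟨ι⟩ : Nonempty (K →+* ℂ) := inferInstance
  obtain ⟨P, hP⟩ := heegnerPointComplex_mem_range_map_holds (W.conductorNorm ℤ) W K hK hHN D H ι
  have hD0 : (NumberField.discr K : ℚ) ≠ 0 := by exact_mod_cast NumberField.discr_ne_zero K
  haveI hEt : (W.quadraticTwist (NumberField.discr K : ℚ)).IsElliptic :=
    W.isElliptic_quadraticTwist hD0
  obtain ⟨Cd, hCd⟩ := hasGlobalMinimalModel_rat_holds (W.quadraticTwist (NumberField.discr K : ℚ))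
  haveI : (Cd • W.quadraticTwist (NumberField.discr K : ℚ)).IsGloballyMinimal := hCd
  have hWd : Cd • W.quadraticTwist (NumberField.discr K : ℚ) =
      Cd • W.quadraticTwist (NumberField.discr K : ℚ) := rfl
  have hrd : (Cd • W.quadraticTwist (NumberField.discr K : ℚ)).analyticRank = 0 := by
    rw [analyticRank_smul]
    exact analyticRank_eq_zero_of_entireLFunction_one_ne_zero _ hLt
  have hlowd : MissingLowerBoundAt (Cd • W.quadraticTwist (NumberField.discr K : ℚ)) p :=
    missingLowerBoundAt_twist_of_hasCM hCM8 hmod hGZK W hCM p hD0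
      (Cd • W.quadraticTwist (NumberField.discr K : ℚ)) ⟨Cd, rfl⟩ hrd
  have hirrd : (Cd • W.quadraticTwist (NumberField.discr K : ℚ)).HasIrreducibleModPGaloisRep p :=
    X11b.hasIrreducibleModPGaloisRep_twist_model W p K hK.1 hirr Cd hWd
  have htam : padicValNat p (Cd • W.quadraticTwist (NumberField.discr K : ℚ)).tamagawaProduct =
      padicValNat p W.tamagawaProduct :=
    X2.padicValNat_tamagawaProduct_twist_of_heegner_of_odd W p hp2 K hK hodd hpd hHN Cd hWd
  have hu : padicValRat p (Cd.u : ℚ) = 0 :=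
    AdditivePotMult.padicValRat_u_eq_zero_of_twist_minimal_of_split W p K hK hHp Cd hWd
  obtain ⟨qd, hqd, hvqd⟩ :=
    AdditivePotMult.exists_printShape_lower_of_missingLowerBoundAt_rankZero (p := p)
      (Cd • W.quadraticTwist (NumberField.discr K : ℚ)) hGZK hrd hirrd hlowd
  exact X11b.padicValNat_shaOrder_le_add_of_shaIndexBound W p (W.conductorNorm ℤ) K D H ι P
    (hGZ _ W K) (hKo _ W K) hGZK hmod hK hHN hP hp2 hc hμ hr hLt
    (Cd • W.quadraticTwist (NumberField.discr K : ℚ)) Cd hWd hu htam ⟨qd, hqd, hvqd⟩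
    (fun _ hnt ↦ hMN _ W K hK hHN hD3 hD4 ⟨D, H, ι, hP⟩ hnt hp hp2 hirr)

/-- **The UPPER half for a CM curve of analytic rank one at ANY odd prime unramified in the CM
field, ANY conductor** (plus `p ∤ ∏_ℓ c_ℓ(E)`, a per-pair datum at `p = 3`, automatic at `p ≥ 5`).
[cite: FriedbergHoffstein1995, Thm. B] [cite: MatarNekovar2019, Thm. 0.3 and §0.11]
[cite: BurungaleFlach2024, Thm. 1.1 and Cor. 2] [cite: Miller2011LMS, Def. 1.1] -/
theorem missingUpperBoundAt_of_hasCM_rankOne_of_odd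
    (W : WeierstrassCurve ℚ) [W.IsElliptic] [W.IsGloballyMinimal] (p : ℕ) [Fact p.Prime]
    [NeZero (W.conductorNorm ℤ)]
    (hCM : W.HasCM) (hr : W.analyticRank = 1) (hp2 : p ≠ 2) (hnr : ¬ CMRamified W p)
    (D : ModularParametrizationData W (W.conductorNorm ℤ)) (hc : ¬ (p : ℤ) ∣ D.c)
    (htam : ¬ p ∣ W.tamagawaProduct) :
    MissingUpperBoundAt W p := by
  obtain ⟨q, hq, hle⟩ := padicValNat_shaOrder_le_of_hasCM_rankOne_of_odd hGZ hKo hMN hGZK hmod hnf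
    hFH2 hCM8 W p hCM hr hp2 hnr D hc
  refine ⟨q, hq, ?_⟩
  rw [padicValNat.eq_zero_of_not_dvd htam, Nat.cast_zero, mul_zero, add_zero] at hle
  exact hle

/-- **Route T-KR with the curve's own Manin datum, ANY conductor**: `BSD(E,p)` from `p ∤ c(D)`,
`p ∤ ∏c_ℓ` and a certified `p`-adic unit `#Ш(E)_an`. [cite: FriedbergHoffstein1995, Thm. B]
[cite: MatarNekovar2019, Thm. 0.3 and §0.11] [cite: Miller2011LMS, §1 and Def. 1.1] -/
theorem bsdp_of_hasCM_rankOne_of_odd_of_shaAn_unit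
    (W : WeierstrassCurve ℚ) [W.IsElliptic] [W.IsGloballyMinimal] (p : ℕ) [Fact p.Prime]
    [NeZero (W.conductorNorm ℤ)]
    (hCM : W.HasCM) (hr : W.analyticRank = 1) (hp2 : p ≠ 2) (hnr : ¬ CMRamified W p)
    (D : ModularParametrizationData W (W.conductorNorm ℤ)) (hc : ¬ (p : ℤ) ∣ D.c)
    (htam : ¬ p ∣ W.tamagawaProduct) {q : ℚ} (hq : shaAn W = (q : ℂ))
    (hv : padicValRat p q = 0) : BSDp W p :=
  bsdp_of_missingPPartAt W p hGZK (by rw [hr])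
    (missingPPartAt_of_lower_of_upper W p (missingLowerBoundAt_of_shaAn_unit hq hv)
      (missingUpperBoundAt_of_hasCM_rankOne_of_odd hGZ hKo hMN hGZK hmod hnf hFH2 hCM8 W p hCM hr hp2
        hnr D hc htam))

/-! ### §2 At a GOOD odd `p ∤ d_K` (Kobayashi's corner, `p = 3` included), ANY conductor: EVERY curve, NO Manin datum -/

/-- **CM, ANALYTIC RANK ONE, GOOD ODD `p` UNRAMIFIED IN THE CM FIELD, ANY CONDUCTOR — EVERY CURVE:
THE UPPER HALF OF `BSD(E,p)` FROM PUBLISHED FACTS + the class Tamagawa datum** (`htam`: `p ∤ ∏c_ℓ`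
for every globally minimal member of the `ℚ`-isogeny class; automatic at `p ≥ 5`). Modularity
supplies the lattice-optimal member `W₀ ∼ W` (`exists_isIsogenous_optimal`), Mazur's Cor. 4.1
(`hMazur`) gives `p ∤ c(D₀)`, §1 gives the half for `W₀`, Cassels (`hCassels`) moves it to `W`.
[cite: Mazur1978, Cor. 4.1] [cite: FriedbergHoffstein1995, Thm. B]
[cite: MatarNekovar2019, Thm. 0.3 and §0.11] [cite: MilneADT2006, Thm. I.7.3 and Remark I.7.4] -/
theorem missingUpperBoundAt_of_hasCM_rankOne_of_good_odd
    (hMazur : mazur_not_dvd_maninConstant_of_odd) (hCassels : bsdRHS_eq_of_isIsogenous)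
    (W : WeierstrassCurve ℚ) [W.IsElliptic] [W.IsGloballyMinimal] (p : ℕ) [Fact p.Prime]
    (hCM : W.HasCM) (hr : W.analyticRank = 1) (hp2 : p ≠ 2) (hgood : Good W p)
    (hnr : ¬ CMRamified W p)
    (htam : ∀ (W' : WeierstrassCurve ℚ) [W'.IsElliptic] [W'.IsGloballyMinimal],
      IsIsogenous W W' → ¬ p ∣ W'.tamagawaProduct) :
    MissingUpperBoundAt W p := by
  obtain ⟨W₀, hE₀, hM₀, hN₀, D₀, hiso, hN, hopt⟩ := exists_isIsogenous_optimal hnf W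
  have hpN : ¬ p ∣ W.conductorNorm ℤ := fun h ↦
    ((W.dvd_conductorNorm_iff_not_hasGoodReductionAtPrime p).mp h) hgood
  have hpN₀ : ¬ p ∣ W₀.conductorNorm ℤ := by rw [hN]; exact hpN
  have hCM₀ : W₀.HasCM := hasCM_of_isIsogenous hiso hCM
  have hr₀ : W₀.analyticRank = 1 := (analyticRank_eq_of_isIsogenous' hiso) ▸ hr
  have hnr₀ : ¬ CMRamified W₀ p := fun h ↦ hnr ((cmRamified_iff_of_isIsogenous hiso hCM p).mpr h)
  have hc₀ : ¬ (p : ℤ) ∣ D₀.c :=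
    not_dvd_maninConstant_of_optimal_of_good_odd hMazur W₀ p hp2 hpN₀ D₀ hopt
  have hup₀ : MissingUpperBoundAt W₀ p :=
    missingUpperBoundAt_of_hasCM_rankOne_of_odd hGZ hKo hMN hGZK hmod hnf hFH2 hCM8 W₀ p hCM₀ hr₀
      hp2 hnr₀ D₀ hc₀ (htam W₀ hiso)
  exact missingUpperBoundAt_of_isIsogenous hCassels hiso (hGZK W₀ (by rw [hr₀])).2
    (W₀.leadingLCoeff_ne_zero_holds (hmod W₀)) hup₀

/-- **For every such curve: `BSD(E,p) ⟺ MissingLowerBoundAt W p`** — at a good odd `p ∤ d_K` of a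
CM curve of analytic rank one (any conductor) the residue is exactly the main-conjecture half.
[cite: Mazur1978, Cor. 4.1] [cite: FriedbergHoffstein1995, Thm. B]
[cite: MatarNekovar2019, Thm. 0.3 and §0.11] [cite: Miller2011LMS, §1 and Def. 1.1] -/
theorem bsdp_iff_missingLowerBoundAt_of_hasCM_rankOne_of_good_odd
    (hMazur : mazur_not_dvd_maninConstant_of_odd) (hCassels : bsdRHS_eq_of_isIsogenous)
    (W : WeierstrassCurve ℚ) [W.IsElliptic] [W.IsGloballyMinimal] (p : ℕ) [Fact p.Prime]
    (hCM : W.HasCM) (hr : W.analyticRank = 1) (hp2 : p ≠ 2) (hgood : Good W p)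
    (hnr : ¬ CMRamified W p)
    (htam : ∀ (W' : WeierstrassCurve ℚ) [W'.IsElliptic] [W'.IsGloballyMinimal],
      IsIsogenous W W' → ¬ p ∣ W'.tamagawaProduct) :
    BSDp W p ↔ MissingLowerBoundAt W p := by
  refine ⟨fun hb ↦ ?_, fun hlow ↦ ?_⟩
  · haveI : Finite W.sha := (hGZK W (by rw [hr])).2
    exact (lower_and_upper_of_missingPPartAt W p (missingPPartAt_of_bsdp W p hb)).1
  · exact bsdp_of_missingPPartAt W p hGZK (by rw [hr])
      (missingPPartAt_of_lower_of_upper W p hlow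
        (missingUpperBoundAt_of_hasCM_rankOne_of_good_odd hGZ hKo hMN hGZK hmod hnf hFH2 hCM8 hMazur
          hCassels W p hCM hr hp2 hgood hnr htam))

/-- **The cell's typed input `X12.MissingInputAt W p` for every such curve FOLLOWS from the
curve's own lower half.** [cite: Mazur1978, Cor. 4.1] [cite: MatarNekovar2019, Thm. 0.3 and §0.11] -/
theorem missingInputAt_of_hasCM_rankOne_of_good_odd_of_lower
    (hMazur : mazur_not_dvd_maninConstant_of_odd) (hCassels : bsdRHS_eq_of_isIsogenous)
    (W : WeierstrassCurve ℚ) [W.IsElliptic] [W.IsGloballyMinimal] (p : ℕ) [Fact p.Prime]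
    (hCM : W.HasCM) (hr : W.analyticRank = 1) (hp2 : p ≠ 2) (hgood : Good W p)
    (hnr : ¬ CMRamified W p)
    (htam : ∀ (W' : WeierstrassCurve ℚ) [W'.IsElliptic] [W'.IsGloballyMinimal],
      IsIsogenous W W' → ¬ p ∣ W'.tamagawaProduct)
    (hlow : MissingLowerBoundAt W p) : X12.MissingInputAt W p := fun _ ↦
  missingPPartAt_of_lower_of_upper W p hlow
    (missingUpperBoundAt_of_hasCM_rankOne_of_good_odd hGZ hKo hMN hGZK hmod hnf hFH2 hCM8 hMazur
      hCassels W p hCM hr hp2 hgood hnr htam)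

/-- **ROUTE T-KR3G, ANY CONDUCTOR — `BSD(E,p)` at a GOOD odd `p ∤ d_K` for EVERY CM curve of
analytic rank one, from `r_an = 1`, a certified `p`-adic unit `#Ш(E)_an = q` and the class Tamagawa
datum ALONE.** No Iwasawa theory at `p`, no `p`-adic height, no Heegner index, no descent, no Manin
table, no optimality, no parity of the conductor. An independent second basis, resting on read
primaries, for the whole `p ∤ d_K` part of the corner the partition routes to Kobayashi 2013
Cor. 1.4 (lane row `T-KOB13@3`, held). [cite: Mazur1978, Cor. 4.1] [cite: FriedbergHoffstein1995, Thm. B]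
[cite: MatarNekovar2019, Thm. 0.3 and §0.11] [cite: BurungaleFlach2024, Thm. 1.1 and Cor. 2]
[cite: Miller2011LMS, §1 and Def. 1.1] -/
theorem bsdp_of_hasCM_rankOne_of_good_odd_of_shaAn_unit
    (hMazur : mazur_not_dvd_maninConstant_of_odd) (hCassels : bsdRHS_eq_of_isIsogenous)
    (W : WeierstrassCurve ℚ) [W.IsElliptic] [W.IsGloballyMinimal] (p : ℕ) [Fact p.Prime]
    (hCM : W.HasCM) (hr : W.analyticRank = 1) (hp2 : p ≠ 2) (hgood : Good W p)
    (hnr : ¬ CMRamified W p)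
    (htam : ∀ (W' : WeierstrassCurve ℚ) [W'.IsElliptic] [W'.IsGloballyMinimal],
      IsIsogenous W W' → ¬ p ∣ W'.tamagawaProduct)
    {q : ℚ} (hq : shaAn W = (q : ℂ)) (hv : padicValRat p q = 0) : BSDp W p :=
  (bsdp_iff_missingLowerBoundAt_of_hasCM_rankOne_of_good_odd hGZ hKo hMN hGZK hmod hnf hFH2 hCM8
    hMazur hCassels W p hCM hr hp2 hgood hnr htam).mpr (missingLowerBoundAt_of_shaAn_unit hq hv)

/-! ### §3 At a GOOD `p ≥ 5` unramified in the CM field, ANY conductor: EVERY curve, no datum at all -/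

/-- **CM, analytic rank one, GOOD `p ≥ 5` unramified in the CM field, ANY conductor — EVERY curve:
`BSD(E,p) ⟺ MissingLowerBoundAt W p`, no binder but published named facts and the cell predicates**
(the class Tamagawa datum is automatic: `not_dvd_tamagawaProduct_of_hasCM` on each member, CM by
`hasCM_of_isIsogenous`). [cite: Mazur1978, Cor. 4.1] [cite: FriedbergHoffstein1995, Thm. B]
[cite: MatarNekovar2019, Thm. 0.3 and §0.11] [cite: SilvermanATAEC1994, Cor. IV.9.2(d)] -/
theorem bsdp_iff_missingLowerBoundAt_of_hasCM_rankOne_of_good_of_five_le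
    (hMazur : mazur_not_dvd_maninConstant_of_odd) (hCassels : bsdRHS_eq_of_isIsogenous)
    (W : WeierstrassCurve ℚ) [W.IsElliptic] [W.IsGloballyMinimal] (p : ℕ) [Fact p.Prime]
    (hCM : W.HasCM) (hr : W.analyticRank = 1) (hp5 : 5 ≤ p) (hgood : Good W p)
    (hnr : ¬ CMRamified W p) : BSDp W p ↔ MissingLowerBoundAt W p :=
  bsdp_iff_missingLowerBoundAt_of_hasCM_rankOne_of_good_odd hGZ hKo hMN hGZK hmod hnf hFH2 hCM8
    hMazur hCassels W p hCM hr (by omega) hgood hnr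
    (fun W' _ _ hiso ↦ not_dvd_tamagawaProduct_of_hasCM W' (hasCM_of_isIsogenous hiso hCM) p hp5)

/-- **Route T-KR at a GOOD `p ≥ 5` unramified in the CM field for EVERY CM curve of analytic rank
one, any conductor: `BSD(E,p)` from `r_an = 1` and a certified `p`-adic unit `#Ш(E)_an` ALONE.**
[cite: Mazur1978, Cor. 4.1] [cite: FriedbergHoffstein1995, Thm. B]
[cite: MatarNekovar2019, Thm. 0.3 and §0.11] [cite: BurungaleFlach2024, Thm. 1.1 and Cor. 2] -/
theorem bsdp_of_hasCM_rankOne_of_good_of_five_le_of_shaAn_unit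
    (hMazur : mazur_not_dvd_maninConstant_of_odd) (hCassels : bsdRHS_eq_of_isIsogenous)
    (W : WeierstrassCurve ℚ) [W.IsElliptic] [W.IsGloballyMinimal] (p : ℕ) [Fact p.Prime]
    (hCM : W.HasCM) (hr : W.analyticRank = 1) (hp5 : 5 ≤ p) (hgood : Good W p)
    (hnr : ¬ CMRamified W p) {q : ℚ} (hq : shaAn W = (q : ℂ)) (hv : padicValRat p q = 0) :
    BSDp W p :=
  (bsdp_iff_missingLowerBoundAt_of_hasCM_rankOne_of_good_of_five_le hGZ hKo hMN hGZK hmod hnf hFH2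
    hCM8 hMazur hCassels W p hCM hr hp5 hgood hnr).mpr (missingLowerBoundAt_of_shaAn_unit hq hv)

end Summit.BirchSwinnertonDyer.Rank1Residual.X12

end
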